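import Literature.Analysis.FluidPDE.AxisymmetricLiftR5
import Literature.Analysis.FluidPDE.NSVorticityEnergy
import Mathlib.MeasureTheory.Integral.DivergenceTheorem
import HarnessLib

/-!
# Symmetry-plane flux law, I (kinematics) — on a mirror plane the normal component of the
# vorticity nonlinearity is a planar divergence; over a FIXED plane region it is pure edge transport

HONEST FRAMING (cell `ns-blowup`, lane W «gathering number», seat `ns-blowup-wind`; human ruling
D-0035). WHAT THIS IS NOT: not a statement about Navier–Stokes blow-up in either direction, and
not a statement about any particular flow: classical kinematics of smooth vector fields
equivariant under a coordinate reflection, kernel-checked because it is the EXACT half of the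
lane-W mechanism word of record (RESULT «P-WIND-NF», HOME/wind/RESULT-P-WIND-NF.md §4 M2,
refuter-endorsed as kinematics): *in the receding-pair class every material crossing point of the
antipode plane is expelled, so flux re-appearing inside the fixed diameter cannot have entered
inviscidly — it is viscous bridging `ν ∂²_z ω_z`*. Every lane-W design the cell ran (head-on /
mirror-image ring collisions RR, RR-b, RC, RA, NF) lives in the symmetry class treated here: the
velocity is equivariant under the reflection `σᵢ = reflC i` of `ℝ³` in the `i`-th coordinate
(tree: `Literature.Analysis.FluidPDE.reflC`, `IsEvenC`, `IsOddC`), `u (σᵢ x) = σᵢ (u x)`.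
The companion file `SymmetryPlaneVorticityBudget.lean` applies this to classical Navier–Stokes /
Euler solutions (`IsClassicalNSSolutionOn`). All proved; 0 `sorry`; no definitions, no named facts.

§1 *Parity.* For a mirror-equivariant field `uᵢ` is odd and `uⱼ` (`j ≠ i`) even in `xᵢ`; the
mirror plane `{xᵢ = 0}` is invariant (`uᵢ = 0` there, `apply_same_eq_zero`); on the plane
`∂ᵢuⱼ = 0 = ∂ⱼuᵢ` for `j ≠ i`, hence **the vorticity is normal to the plane**:
`(curl u)ⱼ = 0` for `j ≠ i` (`curl_apply_eq_zero_of_ne`).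
§2 *Pointwise law.* Where `uᵢ = 0`, `ωⱼ = 0 (j ≠ i)` and `∑ⱼ∂ⱼuⱼ = 0`, the `i`-th component of
the vorticity-equation nonlinearity (transport minus stretching, the tree's sign convention
`curl W t − curl W s = ∫ (Δ curl W − D(curl W)[W] + DW[curl W])`) is a PLANAR DIVERGENCE,
`(Dω[u] − Du[ω])ᵢ = ∑_{j ≠ i} ∂ⱼ(uⱼ ωᵢ)` (`transport_sub_stretch_apply_eq_sum`,
`transport_sub_stretch_curl_eq_sum`).
§3 *Integrated law.* Over a rectangle `R` of the plane (chart `P (s,t) = s e_{i+1} + t e_{i+2}`),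
by Mathlib's divergence theorem (`MeasureTheory.integral_divergence_prod_Icc_of_hasFDerivAt_of_le`):
`∫_R ∑_{j≠i} ∂ⱼ(uⱼωᵢ) = ∮_{∂R} ωᵢ (u · n_out)` (`setIntegral_sum_pderiv_mul_eq_edges`), so
`∫_R (Dω[u] − Du[ω])ᵢ = ∮_{∂R} ωᵢ (u · n_out)` (`setIntegral_transport_sub_stretch_eq_edges`,
`…_curl_eq_edges`); SIGN FORM (`setIntegral_sum_pderiv_mul_nonneg_of_outflow`): with `ωᵢ ≥ 0` on
`∂R` and the in-plane velocity pointing outward there, the edge transport is `≥ 0` — read along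
`∂ₜω = −(Dω[u] − Du[ω]) + νΔω (+ curl f)`, the inviscid budget of the normal-vorticity content
`∫_R ωᵢ` of a FIXED plane region is then `≤ 0`: co-signed normal flux is carried OUT of a fixed
plane region by the plane's material points, never in («Kelvin bookkeeping on the plane» behind
census token (i′) «RECONNECTIVE TRANSFER-ONLY»; MODEL numbers stay in the memo).

Mathlib / tree search: Mathlib has the rectangle divergence theorem and `fderiv_fun_mul`; curl,
reflection parity (`IsEvenC.isOddC_fderiv_apply_same` &c., `AxisymmetricLiftR5`), `pderiv`,
`euclidean_fderiv_apply_comp`, `fderiv_apply_eq_sum_mul_pderiv` are the tree's. The tree's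
`MirrorWall.lean` (FluidComputer) proves impermeability of lattice mirror planes for Galerkin
truncations (`field_zero_on_faces`) — §1's `apply_same_eq_zero` in Fourier form; nothing on the
vorticity budget of a plane region existed (`lean search 'reflC|IsEvenC|mirror'`).
References (classical; no new mathematics): Majda–Bertozzi, *Vorticity and Incompressible
Flow*, CUP 2002, §1.4 (1.32)–(1.33), §2.3; Saffman, *Vortex Dynamics*, CUP 1992, §1.5, §2.4. -/

noncomputable section

open MeasureTheory Set Function
open scoped BigOperators

namespace Summit.NavierStokesRegularity.FluidComputer.SymmetryPlaneFluxLaw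

open Literature.Analysis.FluidPDE

/-! ### §1 Mirror-equivariant fields: parity, invariance of the plane, normal vorticity -/

section Parity

variable {i : Fin 3} {u : EuclideanSpace ℝ (Fin 3) → EuclideanSpace ℝ (Fin 3)}

/-- Components of a differentiable field are differentiable (projection chain rule). -/
theorem differentiable_apply (hd : Differentiable ℝ u) (j : Fin 3) :
    Differentiable ℝ fun y => u y j := by
  have h : (fun y => u y j) = (EuclideanSpace.proj j : EuclideanSpace ℝ (Fin 3) →L[ℝ] ℝ) ∘ u := rfl
  rw [h]
  exact (EuclideanSpace.proj j).differentiable.comp hd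

/-- **The normal velocity component of a mirror-equivariant field is odd** in the mirrored
coordinate: `u (σᵢ x) = σᵢ (u x)` for the coordinate reflection `σᵢ = reflC i` gives
`uᵢ (σᵢ x) = −uᵢ (x)`. -/
theorem isOddC_apply_same (hu : ∀ x, u (reflC i x) = reflC i (u x)) :
    IsOddC i fun x => u x i := fun x => by
  simp only [hu x, reflC_apply_same]

/-- **The tangential velocity components of a mirror-equivariant field are even** in the
mirrored coordinate: `uⱼ (σᵢ x) = uⱼ (x)` for `j ≠ i`. -/
theorem isEvenC_apply_of_ne (hu : ∀ x, u (reflC i x) = reflC i (u x)) {j : Fin 3} (hj : j ≠ i) :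
    IsEvenC i fun x => u x j := fun x => by
  simp only [hu x, reflC_apply_of_ne hj]

/-- **The mirror plane is invariant**: the normal velocity `uᵢ` vanishes on `{xᵢ = 0}` for a
mirror-equivariant field (no regularity needed). -/
theorem apply_same_eq_zero (hu : ∀ x, u (reflC i x) = reflC i (u x))
    {x : EuclideanSpace ℝ (Fin 3)} (hx : x i = 0) : u x i = 0 :=
  (isOddC_apply_same hu).eq_zero hx

/-- On the mirror plane the normal derivative of a tangential component vanishes:
`∂ᵢ uⱼ = 0` on `{xᵢ = 0}` for `j ≠ i` (even function, odd derivative). -/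
theorem pderiv_same_apply_of_ne_eq_zero (hu : ∀ x, u (reflC i x) = reflC i (u x))
    (hd : Differentiable ℝ u) {j : Fin 3} (hj : j ≠ i)
    {x : EuclideanSpace ℝ (Fin 3)} (hx : x i = 0) : pderiv i (fun y => u y j) x = 0 :=
  ((isEvenC_apply_of_ne hu hj).isOddC_fderiv_apply_same (differentiable_apply hd j)).eq_zero hx

/-- On the mirror plane the tangential derivatives of the normal component vanish:
`∂ₖ uᵢ = 0` on `{xᵢ = 0}` for `k ≠ i` (odd function restricted to its zero set). -/
theorem pderiv_of_ne_apply_same_eq_zero (hu : ∀ x, u (reflC i x) = reflC i (u x))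
    (hd : Differentiable ℝ u) {k : Fin 3} (hk : k ≠ i)
    {x : EuclideanSpace ℝ (Fin 3)} (hx : x i = 0) : pderiv k (fun y => u y i) x = 0 :=
  ((isOddC_apply_same hu).isOddC_fderiv_apply_of_ne (differentiable_apply hd i) hk).eq_zero hx

/-- The two vanishing statements combined: on the plane, `∂ₖ uₗ (x) = 0` whenever `k ≠ l` and one
of `k, l` is the mirrored index. -/
theorem fderiv_apply_eq_zero_of_plane (hu : ∀ x, u (reflC i x) = reflC i (u x))
    (hd : Differentiable ℝ u) {k l : Fin 3} (hkl : k ≠ l) (h : k = i ∨ l = i)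
    {x : EuclideanSpace ℝ (Fin 3)} (hx : x i = 0) :
    fderiv ℝ u x (EuclideanSpace.single k 1) l = 0 := by
  rw [euclidean_fderiv_apply_comp (hd x)]
  rcases h with rfl | rfl
  · exact pderiv_same_apply_of_ne_eq_zero hu hd hkl.symm hx
  · exact pderiv_of_ne_apply_same_eq_zero hu hd hkl hx

/-- **On a mirror plane the vorticity is normal to the plane**: for a differentiable
mirror-equivariant field, `(curl u)ⱼ = 0` on `{xᵢ = 0}` for every `j ≠ i` (each of the two
partial derivatives in `(curl u)ⱼ` is either a normal derivative of a tangential component or a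
tangential derivative of the normal component). -/
theorem curl_apply_eq_zero_of_ne (hu : ∀ x, u (reflC i x) = reflC i (u x))
    (hd : Differentiable ℝ u) {j : Fin 3} (hj : j ≠ i)
    {x : EuclideanSpace ℝ (Fin 3)} (hx : x i = 0) : curl u x j = 0 := by
  have h0 : ∀ k l : Fin 3, k ≠ l → (k = i ∨ l = i) →
      fderiv ℝ u x (EuclideanSpace.single k 1) l = 0 :=
    fun k l hkl h => fderiv_apply_eq_zero_of_plane hu hd hkl h hx
  fin_cases i <;> fin_cases j <;> simp_all [curl]

end Parity

/-! ### §2 The pointwise law: normal transport-minus-stretching is a planar divergence -/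

section Pointwise

variable {u ω : EuclideanSpace ℝ (Fin 3) → EuclideanSpace ℝ (Fin 3)} {x : EuclideanSpace ℝ (Fin 3)}

/-- **Pointwise symmetry-plane law (abstract form).** At a point `x` where the field `u` is
tangent to the coordinate plane normal to `eᵢ` (`uᵢ (x) = 0`), the field `ω` is normal to it
(`ωⱼ (x) = 0` for `j ≠ i`) and `u` is divergence free (`∑ⱼ ∂ⱼuⱼ (x) = 0`), the `i`-th component
of the vorticity-equation nonlinearity `Dω(x)[u(x)] − Du(x)[ω(x)]` (transport minus stretching,
the tree's sign convention `curl W t − curl W s = ∫ (Δ curl W − D(curl W)[W] + DW[curl W])`) is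
the planar divergence of the in-plane flux `ωᵢ u_∥`:
`(Dω[u] − Du[ω])ᵢ = ∑_{j ≠ i} ∂ⱼ (uⱼ ωᵢ)`. Pure calculus: product rule and `∂ᵢuᵢ = −∑_{j≠i} ∂ⱼuⱼ`. -/
theorem transport_sub_stretch_apply_eq_sum (i : Fin 3)
    (hu : DifferentiableAt ℝ u x) (hω : DifferentiableAt ℝ ω x)
    (hui : u x i = 0) (hωj : ∀ j, j ≠ i → ω x j = 0)
    (hdiv : ∑ j, pderiv j (fun y => u y j) x = 0) :
    fderiv ℝ ω x (u x) i - fderiv ℝ u x (ω x) i =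
      ∑ j ∈ Finset.univ.erase i, pderiv j (fun y => u y j * ω y i) x := by
  have hui' : ∀ j, DifferentiableAt ℝ (fun y => u y j) x := fun j => by
    have h : (fun y => u y j) = (EuclideanSpace.proj j : EuclideanSpace ℝ (Fin 3) →L[ℝ] ℝ) ∘ u := rfl
    rw [h]; exact (EuclideanSpace.proj j).differentiableAt.comp x hu
  have hωi' : ∀ j, DifferentiableAt ℝ (fun y => ω y j) x := fun j => by
    have h : (fun y => ω y j) = (EuclideanSpace.proj j : EuclideanSpace ℝ (Fin 3) →L[ℝ] ℝ) ∘ ω := rfl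
    rw [h]; exact (EuclideanSpace.proj j).differentiableAt.comp x hω
  -- product rule inside the planar divergence
  have hprod : ∀ j, pderiv j (fun y => u y j * ω y i) x =
      u x j * pderiv j (fun y => ω y i) x + ω x i * pderiv j (fun y => u y j) x := by
    intro j
    rw [pderiv_apply, fderiv_fun_mul (hui' j) (hωi' i)]
    simp only [add_apply, smul_apply, smul_eq_mul, pderiv_apply]
  -- the two terms in coordinates
  have h1 : fderiv ℝ ω x (u x) i = ∑ j, u x j * pderiv j (fun y => ω y i) x := by
    rw [euclidean_fderiv_apply_comp hω, fderiv_apply_eq_sum_mul_pderiv]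
  have h2 : fderiv ℝ u x (ω x) i = ω x i * pderiv i (fun y => u y i) x := by
    rw [euclidean_fderiv_apply_comp hu, fderiv_apply_eq_sum_mul_pderiv]
    rw [← Finset.add_sum_erase _ _ (Finset.mem_univ i)]
    rw [Finset.sum_eq_zero (fun j hj => by rw [hωj j (Finset.ne_of_mem_erase hj), zero_mul]),
      add_zero]
  have h3 : pderiv i (fun y => u y i) x = -∑ j ∈ Finset.univ.erase i, pderiv j (fun y => u y j) x := by
    rw [← Finset.add_sum_erase _ _ (Finset.mem_univ i)] at hdiv
    linarith
  rw [h1, h2, h3, ← Finset.add_sum_erase _ _ (Finset.mem_univ i), hui, zero_mul, zero_add,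
    mul_neg, sub_neg_eq_add, Finset.mul_sum, ← Finset.sum_add_distrib]
  exact Finset.sum_congr rfl fun j _ => by rw [hprod j]

/-- **Pointwise symmetry-plane law for the vorticity of a mirror-equivariant divergence-free
field.** For `u ∈ C²` with `u ∘ σᵢ = σᵢ ∘ u` and `∑ⱼ ∂ⱼuⱼ = 0`, at every point of the mirror
plane `{xᵢ = 0}`:
`(D(curl u)[u] − Du[curl u])ᵢ = ∑_{j ≠ i} ∂ⱼ (uⱼ (curl u)ᵢ)`. -/
theorem transport_sub_stretch_curl_eq_sum {i : Fin 3}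
    (hsym : ∀ x, u (reflC i x) = reflC i (u x)) (hC : ContDiff ℝ 2 u)
    (hdiv : ∀ x, ∑ j, pderiv j (fun y => u y j) x = 0) (hx : x i = 0) :
    fderiv ℝ (curl u) x (u x) i - fderiv ℝ u x (curl u x) i =
      ∑ j ∈ Finset.univ.erase i, pderiv j (fun y => u y j * curl u y i) x := by
  have hd : Differentiable ℝ u := hC.differentiable (by norm_num)
  have hC' : ContDiff ℝ ((1 : ℕ∞) + 1) u := hC.of_le (by norm_num)
  have hcd : Differentiable ℝ (curl u) := (contDiff_curl hC').differentiable one_ne_zero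
  exact transport_sub_stretch_apply_eq_sum i (hd x) (hcd x) (apply_same_eq_zero hsym hx)
    (fun j hj => curl_apply_eq_zero_of_ne hsym hd hj hx) (hdiv x)

end Pointwise

/-! ### §3 The integrated law: over a fixed plane rectangle the nonlinearity is pure edge transport -/

section Integrated

variable {u ω : EuclideanSpace ℝ (Fin 3) → EuclideanSpace ℝ (Fin 3)}

/-- In `Fin 3` the two indices other than `i` are `i + 1` and `i + 2`: a sum over `univ.erase i`. -/
theorem sum_univ_erase_fin_three (φ : Fin 3 → ℝ) (i : Fin 3) :
    ∑ j ∈ Finset.univ.erase i, φ j = φ (i + 1) + φ (i + 2) := by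
  rw [Finset.sum_erase_eq_sub (Finset.mem_univ _), Fin.sum_univ_three]
  fin_cases i <;> simp <;> ring

/-- The coordinate plane `{xᵢ = 0}` parametrised by `(s, t) ↦ s e_{i+1} + t e_{i+2}` lies in the
plane: its `i`-th coordinate vanishes. -/
theorem planeChart_apply_same (i : Fin 3) {P : ℝ × ℝ → EuclideanSpace ℝ (Fin 3)}
    (hP : ∀ q, P q = q.1 • (stdVec (i + 1) : EuclideanSpace ℝ (Fin 3)) + q.2 • stdVec (i + 2))
    (q : ℝ × ℝ) : P q i = 0 := by
  rw [hP]
  have h1 : (i : Fin 3) ≠ i + 1 := by fin_cases i <;> decide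
  have h2 : (i : Fin 3) ≠ i + 2 := by fin_cases i <;> decide
  simp [h1, h2]

/-- The chart `(s, t) ↦ s e_{i+1} + t e_{i+2}` is the continuous linear map
`fst • e_{i+1} + snd • e_{i+2}`; in particular it has that map as its derivative everywhere. -/
theorem hasFDerivAt_planeChart (i : Fin 3) {P : ℝ × ℝ → EuclideanSpace ℝ (Fin 3)}
    (hP : ∀ q, P q = q.1 • (stdVec (i + 1) : EuclideanSpace ℝ (Fin 3)) + q.2 • stdVec (i + 2))
    (q : ℝ × ℝ) :
    HasFDerivAt P
      ((ContinuousLinearMap.fst ℝ ℝ ℝ).smulRight (stdVec (i + 1) : EuclideanSpace ℝ (Fin 3)) +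
        (ContinuousLinearMap.snd ℝ ℝ ℝ).smulRight (stdVec (i + 2) : EuclideanSpace ℝ (Fin 3))) q := by
  have hPe : P = fun q => ((ContinuousLinearMap.fst ℝ ℝ ℝ).smulRight
      (stdVec (i + 1) : EuclideanSpace ℝ (Fin 3)) +
        (ContinuousLinearMap.snd ℝ ℝ ℝ).smulRight (stdVec (i + 2) : EuclideanSpace ℝ (Fin 3))) q := by
    funext q; rw [hP]; simp
  rw [hPe]
  exact ContinuousLinearMap.hasFDerivAt _

/-- Chain rule along the chart: for a `C¹` scalar `F` on `ℝ³`, the pull-back `F ∘ P` has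
derivative `DF(P q) ∘ P'`, whose value on `(1, 0)` is `∂_{i+1} F (P q)` and on `(0, 1)` is
`∂_{i+2} F (P q)`. -/
theorem hasFDerivAt_comp_planeChart (i : Fin 3) {P : ℝ × ℝ → EuclideanSpace ℝ (Fin 3)}
    (hP : ∀ q, P q = q.1 • (stdVec (i + 1) : EuclideanSpace ℝ (Fin 3)) + q.2 • stdVec (i + 2))
    {F : EuclideanSpace ℝ (Fin 3) → ℝ} (hF : Differentiable ℝ F) (q : ℝ × ℝ) :
    HasFDerivAt (F ∘ P)
      ((fderiv ℝ F (P q)).comp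
        ((ContinuousLinearMap.fst ℝ ℝ ℝ).smulRight (stdVec (i + 1) : EuclideanSpace ℝ (Fin 3)) +
          (ContinuousLinearMap.snd ℝ ℝ ℝ).smulRight (stdVec (i + 2) : EuclideanSpace ℝ (Fin 3)))) q :=
  (hF (P q)).hasFDerivAt.comp q (hasFDerivAt_planeChart i hP q)

/-- **Green's formula for the in-plane flux `ωᵢ u_∥` on a coordinate-plane rectangle.** For
`u, ω ∈ C¹(ℝ³; ℝ³)` and the chart `P (s,t) = s e_{i+1} + t e_{i+2}` of the plane `{xᵢ = 0}`,
`∫_{P([a,b])} ∑_{j ≠ i} ∂ⱼ (uⱼ ωᵢ) = [∫ u_{i+2} ωᵢ ds]_{t=a₂}^{t=b₂} + [∫ u_{i+1} ωᵢ dt]_{s=a₁}^{s=b₁}`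
`= ∮_{∂R} ωᵢ (u · n_out)` — Mathlib's divergence theorem on the rectangle
(`integral_divergence_prod_Icc_of_hasFDerivAt_of_le`) pulled back along the chart. No symmetry
is used here. -/
theorem setIntegral_sum_pderiv_mul_eq_edges (i : Fin 3)
    (hu : ContDiff ℝ 1 u) (hω : ContDiff ℝ 1 ω)
    {P : ℝ × ℝ → EuclideanSpace ℝ (Fin 3)}
    (hP : ∀ q, P q = q.1 • (stdVec (i + 1) : EuclideanSpace ℝ (Fin 3)) + q.2 • stdVec (i + 2))
    {a b : ℝ × ℝ} (hab : a ≤ b) :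
    ∫ q in Icc a b, ∑ j ∈ Finset.univ.erase i, pderiv j (fun y => u y j * ω y i) (P q) =
      (((∫ s in a.1..b.1, u (P (s, b.2)) (i + 2) * ω (P (s, b.2)) i) -
          ∫ s in a.1..b.1, u (P (s, a.2)) (i + 2) * ω (P (s, a.2)) i) +
        ∫ t in a.2..b.2, u (P (b.1, t)) (i + 1) * ω (P (b.1, t)) i) -
      ∫ t in a.2..b.2, u (P (a.1, t)) (i + 1) * ω (P (a.1, t)) i := by
  -- the two in-plane fluxes as scalar fields on `ℝ³`
  set F : EuclideanSpace ℝ (Fin 3) → ℝ := fun y => u y (i + 1) * ω y i with hFdef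
  set G : EuclideanSpace ℝ (Fin 3) → ℝ := fun y => u y (i + 2) * ω y i with hGdef
  have huC : ∀ j, ContDiff ℝ 1 fun y => u y j := fun j => contDiff_euclidean.1 hu j
  have hωC : ∀ j, ContDiff ℝ 1 fun y => ω y j := fun j => contDiff_euclidean.1 hω j
  have hFC : ContDiff ℝ 1 F := (huC (i + 1)).mul (hωC i)
  have hGC : ContDiff ℝ 1 G := (huC (i + 2)).mul (hωC i)
  have hFd : Differentiable ℝ F := hFC.differentiable one_ne_zero
  have hGd : Differentiable ℝ G := hGC.differentiable one_ne_zero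
  have hPc : Continuous P := by
    have : P = fun q => q.1 • (stdVec (i + 1) : EuclideanSpace ℝ (Fin 3)) + q.2 • stdVec (i + 2) :=
      funext hP
    rw [this]; fun_prop
  -- the chart derivative and the pulled-back derivatives
  set L : ℝ × ℝ →L[ℝ] EuclideanSpace ℝ (Fin 3) :=
    (ContinuousLinearMap.fst ℝ ℝ ℝ).smulRight (stdVec (i + 1) : EuclideanSpace ℝ (Fin 3)) +
      (ContinuousLinearMap.snd ℝ ℝ ℝ).smulRight (stdVec (i + 2) : EuclideanSpace ℝ (Fin 3)) with hLdef
  have hL10 : L (1, 0) = stdVec (i + 1) := by simp [hLdef]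
  have hL01 : L (0, 1) = stdVec (i + 2) := by simp [hLdef]
  have hdF : ∀ q, HasFDerivAt (F ∘ P) ((fderiv ℝ F (P q)).comp L) q :=
    fun q => hasFDerivAt_comp_planeChart i hP hFd q
  have hdG : ∀ q, HasFDerivAt (G ∘ P) ((fderiv ℝ G (P q)).comp L) q :=
    fun q => hasFDerivAt_comp_planeChart i hP hGd q
  -- the divergence of the pulled-back field is the planar divergence on `ℝ³`
  have hdiv_eq : ∀ q, (fderiv ℝ F (P q)).comp L (1, 0) + (fderiv ℝ G (P q)).comp L (0, 1) =
      ∑ j ∈ Finset.univ.erase i, pderiv j (fun y => u y j * ω y i) (P q) := by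
    intro q
    rw [ContinuousLinearMap.comp_apply, ContinuousLinearMap.comp_apply, hL10, hL01,
      sum_univ_erase_fin_three]
    rfl
  -- continuity of the integrand (for integrability on the compact rectangle)
  have hcont : Continuous fun q : ℝ × ℝ =>
      (fderiv ℝ F (P q)).comp L (1, 0) + (fderiv ℝ G (P q)).comp L (0, 1) := by
    have hcF : Continuous fun y => fderiv ℝ F y := hFC.continuous_fderiv one_ne_zero
    have hcG : Continuous fun y => fderiv ℝ G y := hGC.continuous_fderiv one_ne_zero
    simp only [ContinuousLinearMap.comp_apply]
    exact ((hcF.comp hPc).clm_apply continuous_const).add ((hcG.comp hPc).clm_apply continuous_const)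
  have key := integral_divergence_prod_Icc_of_hasFDerivAt_of_le (F ∘ P) (G ∘ P)
    (fun q => (fderiv ℝ F (P q)).comp L) (fun q => (fderiv ℝ G (P q)).comp L) a b hab
    ((hFd.continuous.comp hPc).continuousOn) ((hGd.continuous.comp hPc).continuousOn)
    (fun q _ => hdF q) (fun q _ => hdG q) (hcont.continuousOn.integrableOn_compact isCompact_Icc)
  simp only [hdiv_eq] at key
  rw [key]
  rfl

/-- **Integrated symmetry-plane law (abstract form).** Let `u, ω ∈ C¹(ℝ³; ℝ³)` with `u` tangent
to the coordinate plane `{xᵢ = 0}` there (`uᵢ = 0` on the plane), `ω` normal to it there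
(`ωⱼ = 0` on the plane for `j ≠ i`) and `u` divergence free. Then over every rectangle
`R = P([a₁,b₁] × [a₂,b₂])` of the plane (chart `P (s,t) = s e_{i+1} + t e_{i+2}`) the integral of
the normal component of the vorticity nonlinearity is PURE EDGE TRANSPORT of `ωᵢ` by the in-plane
velocity:
`∫_R (Dω[u] − Du[ω])ᵢ = ∮_{∂R} ωᵢ (u · n_out) ds`
`= [∫ u_{i+2} ωᵢ ds]_{t=a₂}^{t=b₂} + [∫ u_{i+1} ωᵢ dt]_{s=a₁}^{s=b₁}` (§2 + Green's formula). Read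
along the vorticity equation `∂ₜω = −(Dω[u] − Du[ω]) + νΔω (+ curl f)`: the INVISCID rate of
change of the normal-vorticity content `∫_R ωᵢ` of a FIXED plane region is minus the outward
transport of `ωᵢ` across `∂R` by the (material) in-plane velocity — nothing enters a fixed plane
region inviscidly except across its edge, carried by material points of the invariant plane. -/
theorem setIntegral_transport_sub_stretch_eq_edges (i : Fin 3)
    (hu : ContDiff ℝ 1 u) (hω : ContDiff ℝ 1 ω)
    (hui : ∀ x, x i = 0 → u x i = 0) (hωj : ∀ x, x i = 0 → ∀ j, j ≠ i → ω x j = 0)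
    (hdiv : ∀ x, ∑ j, pderiv j (fun y => u y j) x = 0)
    {P : ℝ × ℝ → EuclideanSpace ℝ (Fin 3)}
    (hP : ∀ q, P q = q.1 • (stdVec (i + 1) : EuclideanSpace ℝ (Fin 3)) + q.2 • stdVec (i + 2))
    {a b : ℝ × ℝ} (hab : a ≤ b) :
    ∫ q in Icc a b, (fderiv ℝ ω (P q) (u (P q)) i - fderiv ℝ u (P q) (ω (P q)) i) =
      (((∫ s in a.1..b.1, u (P (s, b.2)) (i + 2) * ω (P (s, b.2)) i) -
          ∫ s in a.1..b.1, u (P (s, a.2)) (i + 2) * ω (P (s, a.2)) i) +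
        ∫ t in a.2..b.2, u (P (b.1, t)) (i + 1) * ω (P (b.1, t)) i) -
      ∫ t in a.2..b.2, u (P (a.1, t)) (i + 1) * ω (P (a.1, t)) i := by
  have hud : Differentiable ℝ u := hu.differentiable one_ne_zero
  have hωd : Differentiable ℝ ω := hω.differentiable one_ne_zero
  rw [← setIntegral_sum_pderiv_mul_eq_edges i hu hω hP hab]
  refine setIntegral_congr_fun measurableSet_Icc fun q _ => ?_
  have hq : P q i = 0 := planeChart_apply_same i hP q
  exact transport_sub_stretch_apply_eq_sum i (hud _) (hωd _) (hui _ hq) (hωj _ hq) (hdiv _)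

/-- **Integrated symmetry-plane law for the vorticity of a mirror-equivariant divergence-free
field** `u ∈ C²(ℝ³; ℝ³)`, `u ∘ σᵢ = σᵢ ∘ u`, `∑ⱼ ∂ⱼuⱼ = 0`: over every rectangle `R` of the mirror
plane, `∫_R (D(curl u)[u] − Du[curl u])ᵢ = ∮_{∂R} (curl u)ᵢ (u · n_out)`. -/
theorem setIntegral_transport_sub_stretch_curl_eq_edges {i : Fin 3}
    (hsym : ∀ x, u (reflC i x) = reflC i (u x)) (hC : ContDiff ℝ 2 u)
    (hdiv : ∀ x, ∑ j, pderiv j (fun y => u y j) x = 0)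
    {P : ℝ × ℝ → EuclideanSpace ℝ (Fin 3)}
    (hP : ∀ q, P q = q.1 • (stdVec (i + 1) : EuclideanSpace ℝ (Fin 3)) + q.2 • stdVec (i + 2))
    {a b : ℝ × ℝ} (hab : a ≤ b) :
    ∫ q in Icc a b, (fderiv ℝ (curl u) (P q) (u (P q)) i - fderiv ℝ u (P q) (curl u (P q)) i) =
      (((∫ s in a.1..b.1, u (P (s, b.2)) (i + 2) * curl u (P (s, b.2)) i) -
          ∫ s in a.1..b.1, u (P (s, a.2)) (i + 2) * curl u (P (s, a.2)) i) +
        ∫ t in a.2..b.2, u (P (b.1, t)) (i + 1) * curl u (P (b.1, t)) i) -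
      ∫ t in a.2..b.2, u (P (a.1, t)) (i + 1) * curl u (P (a.1, t)) i := by
  have hC1 : ContDiff ℝ 1 u := hC.of_le (by norm_num)
  have hd : Differentiable ℝ u := hC.differentiable (by norm_num)
  have hC' : ContDiff ℝ ((1 : ℕ∞) + 1) u := hC.of_le (by norm_num)
  have hcurl : ContDiff ℝ 1 (curl u) := by exact_mod_cast contDiff_curl hC'
  exact setIntegral_transport_sub_stretch_eq_edges i hC1 hcurl (fun x hx => apply_same_eq_zero hsym hx)
    (fun x hx j hj => curl_apply_eq_zero_of_ne hsym hd hj hx) hdiv hP hab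

/-- **Sign form (the inviscid flux through a fixed plane rectangle cannot grow while the plane
empties).** In the setting of `setIntegral_sum_pderiv_mul_eq_edges`, if on the four edges of the
rectangle the normal vorticity is co-signed, `ωᵢ ≥ 0`, and the in-plane velocity points OUTWARD
(`u_{i+1} ≤ 0` on `s = a₁`, `≥ 0` on `s = b₁`; `u_{i+2} ≤ 0` on `t = a₂`, `≥ 0` on `t = b₂`), then
`∫_R ∑_{j≠i} ∂ⱼ(uⱼ ωᵢ) ≥ 0`, i.e. the inviscid contribution `−∫_R ∑_{j≠i} ∂ⱼ(uⱼ ωᵢ)` to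
`d/dt ∫_R ωᵢ` is `≤ 0`: with the plane's material points leaving the region, co-signed normal flux
can only be carried out, never in. -/
theorem setIntegral_sum_pderiv_mul_nonneg_of_outflow (i : Fin 3)
    (hu : ContDiff ℝ 1 u) (hω : ContDiff ℝ 1 ω)
    {P : ℝ × ℝ → EuclideanSpace ℝ (Fin 3)}
    (hP : ∀ q, P q = q.1 • (stdVec (i + 1) : EuclideanSpace ℝ (Fin 3)) + q.2 • stdVec (i + 2))
    {a b : ℝ × ℝ} (hab : a ≤ b)
    (hωa1 : ∀ t ∈ Icc a.2 b.2, 0 ≤ ω (P (a.1, t)) i) (hωb1 : ∀ t ∈ Icc a.2 b.2, 0 ≤ ω (P (b.1, t)) i)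
    (hωa2 : ∀ s ∈ Icc a.1 b.1, 0 ≤ ω (P (s, a.2)) i) (hωb2 : ∀ s ∈ Icc a.1 b.1, 0 ≤ ω (P (s, b.2)) i)
    (hua1 : ∀ t ∈ Icc a.2 b.2, u (P (a.1, t)) (i + 1) ≤ 0)
    (hub1 : ∀ t ∈ Icc a.2 b.2, 0 ≤ u (P (b.1, t)) (i + 1))
    (hua2 : ∀ s ∈ Icc a.1 b.1, u (P (s, a.2)) (i + 2) ≤ 0)
    (hub2 : ∀ s ∈ Icc a.1 b.1, 0 ≤ u (P (s, b.2)) (i + 2)) :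
    0 ≤ ∫ q in Icc a b, ∑ j ∈ Finset.univ.erase i, pderiv j (fun y => u y j * ω y i) (P q) := by
  rw [setIntegral_sum_pderiv_mul_eq_edges i hu hω hP hab]
  have h1 : 0 ≤ ∫ s in a.1..b.1, u (P (s, b.2)) (i + 2) * ω (P (s, b.2)) i :=
    intervalIntegral.integral_nonneg hab.1 fun s hs => mul_nonneg (hub2 s hs) (hωb2 s hs)
  have h2 : ∫ s in a.1..b.1, u (P (s, a.2)) (i + 2) * ω (P (s, a.2)) i ≤ 0 := by
    have h := intervalIntegral.integral_nonneg (μ := volume) hab.1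
      (f := fun s => -(u (P (s, a.2)) (i + 2) * ω (P (s, a.2)) i))
      fun s hs => by nlinarith [hua2 s hs, hωa2 s hs]
    rw [intervalIntegral.integral_neg] at h
    linarith
  have h3 : 0 ≤ ∫ t in a.2..b.2, u (P (b.1, t)) (i + 1) * ω (P (b.1, t)) i :=
    intervalIntegral.integral_nonneg hab.2 fun t ht => mul_nonneg (hub1 t ht) (hωb1 t ht)
  have h4 : ∫ t in a.2..b.2, u (P (a.1, t)) (i + 1) * ω (P (a.1, t)) i ≤ 0 := by
    have h := intervalIntegral.integral_nonneg (μ := volume) hab.2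
      (f := fun t => -(u (P (a.1, t)) (i + 1) * ω (P (a.1, t)) i))
      fun t ht => by nlinarith [hua1 t ht, hωa1 t ht]
    rw [intervalIntegral.integral_neg] at h
    linarith
  linarith

end Integrated

end Summit.NavierStokesRegularity.FluidComputer.SymmetryPlaneFluxLaw
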